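import Mathlib.Algebra.MvPolynomial.Degrees
import Mathlib.Data.ZMod.Basic
import Mathlib.Logic.Equiv.Fin.Basic
import Literature.Computability.QuantumComplexity.Forrelation
import Literature.Computability.Cryptography.ClassBQP
import HarnessLib

/-!
# Cubic explicit `k`-fold Forrelation (degree-`≤ 3` phase polynomials over `𝔽₂`)

Topic `Literature/Computability/QuantumComplexity` (definition item `defn-cubicKForrelationProblem`,
route `QuantumAdvantage/CubicForrelation`). A companion to `Forrelation.lean`: the SUB-PROMISE of
explicit `k`-fold Forrelation (`kForrelationProblem`, Aaronson–Ambainis 2018 §1.1.3 and §6) in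
which the number of circuits is a fixed `k₀`, the arity `n` is even, and every circuit `Cᵢ`
computes a Boolean function of **algebraic (`𝔽₂`-) degree at most `3`**, i.e.
`fᵢ(x) = (-1)^{pᵢ(x)}` for a polynomial `pᵢ ∈ 𝔽₂[x₁,…,xₙ]` of total degree `≤ 3`. This is
exactly the shape of the instances produced by the `PromiseBQP`-hardness reduction of
Aaronson–Ambainis (2018), §6 Thm 25 ("`C` is a product of at most `3` input bits") and Thm 26
("`fᵢ(x) = (-1)^{p(x)}`, where `p` is a degree-`3` polynomial in the input bits"), so for
`k₀ = poly(n)` the cubic slice is still `PromiseBQP`-complete, while `k₀ = 2` (three Hadamard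
layers around two cubic phase layers) is the first rung of that ladder.

* `polyPhase p : (Fin n → Bool) → Bool` — the Boolean function `x ↦ [p(x) = 1]` of a polynomial
  `p : MvPolynomial (Fin n) (ZMod 2)` (read in `{±1}` through `signOf`, this is the phase
  `(-1)^{p(x)}`);
* `IsDegLeFun d f` — `f : (Fin n → Bool) → Bool` has algebraic degree `≤ d`: some polynomial of
  total degree `≤ d` over `𝔽₂` represents it (Carlet 2020, §2.2.1 Def. 6: the degree of the
  algebraic normal form; any representing polynomial of total degree `≤ d` multilinearises to an
  ANF of degree `≤ d` since `xᵢ² = xᵢ` on `𝔽₂`, so the two readings agree);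
* `cubicKForrelationProblem k₀ : PromiseProblem` — yes: codes of `KForrelationInstance`s `I` with
  `I.IsYes ∧ I.k = k₀ ∧ Even I.n ∧ ∀ i, IsDegLeFun 3 (I.C i).eval`; no: the same with `I.IsNo`;
* `exactCubicForrelationProblem k₀ : PromiseProblem` — the EXACT slice: yes-condition
  `I.IsOverB2 ∧ I.value = 1` (perfectly forrelated) in place of `I.IsYes` (`Φ ≥ 3/5`), same
  no-side;
* API: membership-of-codes iff's, `yes`/`no` parts are subsets of those of `kForrelationProblem`
  (and of each other for the exact slice), disjointness, **sub-promise monotonicity of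
  `PromiseBQP`** (`mem_PromiseBQP_of_subset`) and hence `cubicKForrelationProblem k₀ ∈ PromiseBQP`
  GIVEN `kForrelationProblem ∈ PromiseBQP` (`…_mem_PromiseBQP_of`; the unconditional versions,
  fed by the proved fact `AaronsonAmbainis2018_kForrelation_mem_holds`, live in
  `CubicForrelationMem.lean` to keep this file's imports light), and the `k = 2` unfolding
  `kForrelationValue f = forrelation (f 0) (f 1)` (`kForrelationValue_fin_two`,
  `KForrelationInstance.value_mk_two`, `KForrelationInstance.value_eq_forrelation`);
* `cubicKForrelationProblem_two_eq`, `exactCubicForrelationProblem_two_eq`: the definitions agree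
  BY `rfl` with the inline terms of the route file `Theses/CubicForrelation.lean` (items
  `stmt-QuantumAdvantage-2200…2207`), so those items can be restated verbatim by name.

## Design choices

* The `𝔽₂`-point of `x : Fin n → Bool` is written literally as `fun j => if x j then 1 else 0`
  (definitionally `Literature.Computability.Complexity.Multilinear.boolPt x`, not imported here
  to keep the dependency light), because the route's inline signatures use this literal form.
* `IsDegLeFun` quantifies over ALL polynomials of total degree `≤ d` rather than over the
  (unique) multilinear ANF: equivalent, and it is the form the requester's items use.
* Both promise problems take the number of circuits `k₀` as a parameter (`k₀ = 2` is the route's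
  CF₂; the kill criteria of the route restate at `k₀ = 3`), and require `Even I.n` (odd `n` has no
  perfectly forrelated cubic pairs). The no-side is shared by the two problems.
* Nothing here is specific to degree `3` except the constant in the two problems; `IsDegLeFun d`
  is general.

## References

* S. Aaronson, A. Ambainis, *Forrelation: a problem that optimally separates quantum from
  classical computing*, SIAM J. Comput. 47 (2018) 982–1038 (arXiv:1411.5729): §1.1.3 (k-fold
  Forrelation, thresholds `3/5`, `1/100`), §6 (explicit version, p. 26), Thm 25 and Thm 26
  (p. 27: hardness already for `fᵢ = (-1)^{p}`, `deg p ≤ 3`).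
* C. Carlet, *Boolean Functions for Cryptography and Coding Theory*, CUP 2020, §2.2.1 (algebraic
  normal form, eq. (2.1); Def. 6: algebraic degree, "cubic functions").
* J. Watrous, *Quantum computational complexity* (2009), §III.2 (`PromiseBQP`); O. Goldreich, *On
  promise problems* (2006), §1.1 (restricting the promise).
-/

noncomputable section

open Literature.Computability.Complexity Literature.Computability.Cryptography Finset

namespace Literature.Computability.QuantumComplexity

variable {n k d : ℕ}

/-! ### Boolean functions of bounded algebraic degree -/

/-- The Boolean function `x ↦ [p(x) = 1]` defined by a polynomial `p ∈ 𝔽₂[x₀,…,x_{n-1}]`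
(evaluate `p` at the `𝔽₂`-point of `x ∈ {0,1}ⁿ`); read in `{±1}` through `signOf` this is the
phase `(-1)^{p(x)}` of Aaronson–Ambainis' Thm 26. Every Boolean function arises this way (from its
algebraic normal form). [cite: Carlet2020, §2.2.1 eq. (2.1)] -/
def polyPhase (p : MvPolynomial (Fin n) (ZMod 2)) : (Fin n → Bool) → Bool :=
  fun x => decide (MvPolynomial.eval (fun j => if x j then (1 : ZMod 2) else 0) p = 1)

/-- Unfolding `polyPhase`. [cite: Carlet2020, §2.2.1 eq. (2.1)] -/
theorem polyPhase_apply (p : MvPolynomial (Fin n) (ZMod 2)) (x : Fin n → Bool) :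
    polyPhase p x = decide (MvPolynomial.eval (fun j => if x j then (1 : ZMod 2) else 0) p = 1) :=
  rfl

/-- A constant polynomial defines the corresponding constant Boolean function.
[cite: Carlet2020, §2.2.1 Def. 6] -/
@[simp] theorem polyPhase_C (c : ZMod 2) (x : Fin n → Bool) :
    polyPhase (MvPolynomial.C c) x = decide (c = 1) := by
  simp [polyPhase]

/-- The variable `Xⱼ` defines the projection `x ↦ xⱼ` (a degree-`1` function).
[cite: Carlet2020, §2.2.1 Def. 6] -/
@[simp] theorem polyPhase_X (j : Fin n) (x : Fin n → Bool) :
    polyPhase (MvPolynomial.X j) x = x j := by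
  cases h : x j <;> simp [polyPhase, h]

/-- `f : {0,1}ⁿ → {0,1}` has **algebraic (`𝔽₂`-) degree at most `d`**: it is represented by some
polynomial over `𝔽₂` of total degree `≤ d` (equivalently, its algebraic normal form has degree
`≤ d`; `d = 1`: affine, `d = 2`: quadratic, `d = 3`: cubic functions).
[cite: Carlet2020, §2.2.1 Def. 6] -/
def IsDegLeFun (d : ℕ) (f : (Fin n → Bool) → Bool) : Prop :=
  ∃ p : MvPolynomial (Fin n) (ZMod 2), p.totalDegree ≤ d ∧ ∀ x, f x = polyPhase p x

/-- Unfolding `IsDegLeFun` down to the literal form used in route signatures.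
[cite: Carlet2020, §2.2.1 Def. 6] -/
theorem isDegLeFun_iff (d : ℕ) (f : (Fin n → Bool) → Bool) :
    IsDegLeFun d f ↔ ∃ p : MvPolynomial (Fin n) (ZMod 2), p.totalDegree ≤ d ∧
      ∀ x, f x = decide (MvPolynomial.eval (fun j => if x j then (1 : ZMod 2) else 0) p = 1) :=
  Iff.rfl

/-- A polynomial of total degree `≤ d` defines a function of algebraic degree `≤ d`.
[cite: Carlet2020, §2.2.1 Def. 6] -/
theorem isDegLeFun_polyPhase {p : MvPolynomial (Fin n) (ZMod 2)} (hp : p.totalDegree ≤ d) :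
    IsDegLeFun d (polyPhase p) :=
  ⟨p, hp, fun _ => rfl⟩

/-- Degree bounds are monotone: degree `≤ d` implies degree `≤ d'` for `d ≤ d'`.
[cite: Carlet2020, §2.2.1 Def. 6] -/
theorem IsDegLeFun.mono {d d' : ℕ} {f : (Fin n → Bool) → Bool} (h : IsDegLeFun d f) (hd : d ≤ d') :
    IsDegLeFun d' f := by
  obtain ⟨p, hp, hf⟩ := h
  exact ⟨p, hp.trans hd, hf⟩

/-- Constant functions have algebraic degree `≤ d` for every `d` (the constant polynomial).
[cite: Carlet2020, §2.2.1 Def. 6] -/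
theorem isDegLeFun_const (d : ℕ) (b : Bool) : IsDegLeFun d (fun _ : Fin n → Bool => b) := by
  refine ⟨MvPolynomial.C (if b then 1 else 0), ?_, fun x => ?_⟩
  · exact (MvPolynomial.totalDegree_C _).le.trans (Nat.zero_le _)
  · rw [polyPhase_C]
    show b = _
    cases b <;> decide

/-- Projections `x ↦ xⱼ` have algebraic degree `≤ d` for every `d ≥ 1`.
[cite: Carlet2020, §2.2.1 Def. 6] -/
theorem isDegLeFun_apply (j : Fin n) {d : ℕ} (hd : 1 ≤ d) : IsDegLeFun d (fun x : Fin n → Bool => x j) := by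
  refine ⟨MvPolynomial.X j, (MvPolynomial.totalDegree_X (R := ZMod 2) j).le.trans hd, fun x => ?_⟩
  simp

/-! ### The cubic slices of explicit `k`-fold Forrelation -/

/-- **Cubic explicit `k₀`-fold Forrelation** `CF_{k₀}`: the sub-promise of explicit `k`-fold
Forrelation (`kForrelationProblem`) consisting of the (codes of) instances with exactly `k₀`
circuits, an even number `n` of input bits, and every circuit computing a Boolean function of
algebraic degree `≤ 3` — yes-instances: moreover `B₂`-circuits with `Φ ≥ 3/5` (`IsYes`);
no-instances: moreover `B₂`-circuits with `|Φ| ≤ 1/100` (`IsNo`). The hardness reduction of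
Aaronson–Ambainis only produces such instances (`fᵢ = (-1)^{p}`, `deg p ≤ 3`), so for
`k₀ = poly(n)` this slice is `PromiseBQP`-complete. [cite: AaronsonAmbainis2018, §6 Thm 25 and Thm 26 (p. 27), with §1.1.3] -/
def cubicKForrelationProblem (k₀ : ℕ) : PromiseProblem :=
  ⟨KForrelationInstance.encode ''
      {I | I.IsYes ∧ I.k = k₀ ∧ Even I.n ∧ ∀ i, IsDegLeFun 3 (I.C i).eval},
    KForrelationInstance.encode ''
      {I | I.IsNo ∧ I.k = k₀ ∧ Even I.n ∧ ∀ i, IsDegLeFun 3 (I.C i).eval}⟩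

/-- **Exact cubic `k₀`-fold Forrelation**: the sub-promise of `cubicKForrelationProblem k₀` whose
yes-instances are the PERFECTLY forrelated ones, `Φ = 1` exactly (`B₂`-circuits, `k₀` circuits,
even `n`, all functions of algebraic degree `≤ 3`); the no-side (`|Φ| ≤ 1/100`) is unchanged. For
`k₀ = 2`, `Φ_{f,g} = 1` iff `g` is bent with dual `f`. [cite: AaronsonAmbainis2018, §6 Thm 25 and Thm 26 (p. 27), with §1.1.3] -/
def exactCubicForrelationProblem (k₀ : ℕ) : PromiseProblem :=
  ⟨KForrelationInstance.encode ''
      {I | I.IsOverB2 ∧ I.value = 1 ∧ I.k = k₀ ∧ Even I.n ∧ ∀ i, IsDegLeFun 3 (I.C i).eval},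
    KForrelationInstance.encode ''
      {I | I.IsNo ∧ I.k = k₀ ∧ Even I.n ∧ ∀ i, IsDegLeFun 3 (I.C i).eval}⟩

/-! ### Agreement with the inline signatures of route `QuantumAdvantage/CubicForrelation` -/

/-- `cubicKForrelationProblem 2` is, by `rfl`, the inline promise problem of the route items
`CubicForrelationNotPrBPP`, `CubicForrelationInPrBPP`, `CubicForrelationMemPromiseBQP`.
[cite: AaronsonAmbainis2018, §6 Thm 25 and Thm 26 (p. 27)] -/
theorem cubicKForrelationProblem_two_eq : cubicKForrelationProblem 2 =
    (⟨KForrelationInstance.encode '' {I | I.IsYes ∧ I.k = 2 ∧ Even I.n ∧ ∀ i,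
        ∃ p : MvPolynomial (Fin I.n) (ZMod 2), p.totalDegree ≤ 3 ∧ ∀ x, (I.C i).eval x =
          decide (MvPolynomial.eval (fun j => if x j then (1 : ZMod 2) else 0) p = 1)},
      KForrelationInstance.encode '' {I | I.IsNo ∧ I.k = 2 ∧ Even I.n ∧ ∀ i,
        ∃ p : MvPolynomial (Fin I.n) (ZMod 2), p.totalDegree ≤ 3 ∧ ∀ x, (I.C i).eval x =
          decide (MvPolynomial.eval (fun j => if x j then (1 : ZMod 2) else 0) p = 1)}⟩ :
      PromiseProblem) :=
  rfl

/-- `exactCubicForrelationProblem 2` is, by `rfl`, the inline promise problem of the route item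
`ExactCubicForrelationNotPrBPP`. [cite: AaronsonAmbainis2018, §6 Thm 25 and Thm 26 (p. 27)] -/
theorem exactCubicForrelationProblem_two_eq : exactCubicForrelationProblem 2 =
    (⟨KForrelationInstance.encode '' {I | I.IsOverB2 ∧ I.value = 1 ∧ I.k = 2 ∧ Even I.n ∧ ∀ i,
        ∃ p : MvPolynomial (Fin I.n) (ZMod 2), p.totalDegree ≤ 3 ∧ ∀ x, (I.C i).eval x =
          decide (MvPolynomial.eval (fun j => if x j then (1 : ZMod 2) else 0) p = 1)},
      KForrelationInstance.encode '' {I | I.IsNo ∧ I.k = 2 ∧ Even I.n ∧ ∀ i,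
        ∃ p : MvPolynomial (Fin I.n) (ZMod 2), p.totalDegree ≤ 3 ∧ ∀ x, (I.C i).eval x =
          decide (MvPolynomial.eval (fun j => if x j then (1 : ZMod 2) else 0) p = 1)}⟩ :
      PromiseProblem) :=
  rfl

/-! ### Codes, sub-promises, disjointness -/

/-- The code of an instance is a yes-instance of `CF_{k₀}` iff the instance satisfies the
yes-condition (injectivity of the encoding). [cite: AaronsonAmbainis2018, §6] -/
@[simp] theorem encode_mem_cubicKForrelationProblem_yes_iff (k₀ : ℕ) (I : KForrelationInstance) :
    I.encode ∈ (cubicKForrelationProblem k₀).yes ↔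
      I.IsYes ∧ I.k = k₀ ∧ Even I.n ∧ ∀ i, IsDegLeFun 3 (I.C i).eval :=
  KForrelationInstance.encode_injective.mem_set_image

/-- The code of an instance is a no-instance of `CF_{k₀}` iff the instance satisfies the
no-condition. [cite: AaronsonAmbainis2018, §6] -/
@[simp] theorem encode_mem_cubicKForrelationProblem_no_iff (k₀ : ℕ) (I : KForrelationInstance) :
    I.encode ∈ (cubicKForrelationProblem k₀).no ↔
      I.IsNo ∧ I.k = k₀ ∧ Even I.n ∧ ∀ i, IsDegLeFun 3 (I.C i).eval :=
  KForrelationInstance.encode_injective.mem_set_image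

/-- The code of an instance is a yes-instance of the exact slice iff the instance satisfies the
exact yes-condition. [cite: AaronsonAmbainis2018, §6] -/
@[simp] theorem encode_mem_exactCubicForrelationProblem_yes_iff (k₀ : ℕ) (I : KForrelationInstance) :
    I.encode ∈ (exactCubicForrelationProblem k₀).yes ↔
      I.IsOverB2 ∧ I.value = 1 ∧ I.k = k₀ ∧ Even I.n ∧ ∀ i, IsDegLeFun 3 (I.C i).eval :=
  KForrelationInstance.encode_injective.mem_set_image

/-- The exact slice has the same no-instances as `CF_{k₀}`. [cite: AaronsonAmbainis2018, §6] -/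
@[simp] theorem exactCubicForrelationProblem_no (k₀ : ℕ) :
    (exactCubicForrelationProblem k₀).no = (cubicKForrelationProblem k₀).no :=
  rfl

/-- `CF_{k₀}` is a sub-promise of explicit `k`-fold Forrelation: yes-side.
[cite: AaronsonAmbainis2018, §6] -/
theorem cubicKForrelationProblem_yes_subset (k₀ : ℕ) :
    (cubicKForrelationProblem k₀).yes ≤ kForrelationProblem.yes :=
  Set.image_mono fun _ hI => hI.1

/-- `CF_{k₀}` is a sub-promise of explicit `k`-fold Forrelation: no-side.
[cite: AaronsonAmbainis2018, §6] -/
theorem cubicKForrelationProblem_no_subset (k₀ : ℕ) :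
    (cubicKForrelationProblem k₀).no ≤ kForrelationProblem.no :=
  Set.image_mono fun _ hI => hI.1

/-- A perfectly forrelated `B₂`-instance (`Φ = 1`) is a yes-instance (`Φ ≥ 3/5`).
[cite: AaronsonAmbainis2018, §1.1.3] -/
theorem KForrelationInstance.isYes_of_value_eq_one {I : KForrelationInstance} (hB : I.IsOverB2)
    (hv : I.value = 1) : I.IsYes :=
  ⟨hB, by rw [hv]; norm_num⟩

/-- The exact slice is a sub-promise of `CF_{k₀}`: yes-side (`Φ = 1 ⇒ Φ ≥ 3/5`).
[cite: AaronsonAmbainis2018, §1.1.3 and §6] -/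
theorem exactCubicForrelationProblem_yes_subset (k₀ : ℕ) :
    (exactCubicForrelationProblem k₀).yes ≤ (cubicKForrelationProblem k₀).yes :=
  Set.image_mono fun _ hI => ⟨KForrelationInstance.isYes_of_value_eq_one hI.1 hI.2.1, hI.2.2⟩

/-- `CF_{k₀}` is a genuine (disjoint) promise problem. [cite: AaronsonAmbainis2018, §1.1.3] -/
theorem cubicKForrelationProblem_disjoint (k₀ : ℕ) : (cubicKForrelationProblem k₀).Disjoint :=
  Disjoint.mono (cubicKForrelationProblem_yes_subset k₀) (cubicKForrelationProblem_no_subset k₀)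
    kForrelationProblem_disjoint

/-- The exact slice is a genuine (disjoint) promise problem. [cite: AaronsonAmbainis2018, §1.1.3] -/
theorem exactCubicForrelationProblem_disjoint (k₀ : ℕ) :
    (exactCubicForrelationProblem k₀).Disjoint :=
  Disjoint.mono (exactCubicForrelationProblem_yes_subset k₀) le_rfl
    (cubicKForrelationProblem_disjoint k₀)

/-! ### Sub-promise monotonicity of `PromiseBQP` and membership -/

/-- **`PromiseBQP` is antitone in the promise**: a uniform quantum circuit family deciding `Q`
with error `≤ 1/3` on `Q.yes ∪ Q.no` decides every special case `Q'` (`Q'.yes ⊆ Q.yes`,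
`Q'.no ⊆ Q.no`) with the same guarantee. [cite: Watrous2009, §III.2] -/
theorem mem_PromiseBQP_of_subset {Q Q' : PromiseProblem} (hy : Q'.yes ≤ Q.yes) (hn : Q'.no ≤ Q.no)
    (h : Q ∈ PromiseBQP) : Q' ∈ PromiseBQP := by
  obtain ⟨F, hF, hU, hyes, hno⟩ := h
  exact ⟨F, hF, hU, fun x hx => hyes x (hy hx), fun x hx => hno x (hn hx)⟩

/-- `CF_{k₀} ∈ PromiseBQP` as soon as explicit `k`-fold Forrelation is (sub-promise); the
hypothesis is the proved fact `AaronsonAmbainis2018_kForrelation_mem_holds`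
(`ForrelationMemValue.lean`; unconditional corollary in `CubicForrelationMem.lean`).
[cite: AaronsonAmbainis2018, §6 (p. 26) and §3.2 Prop. 6] -/
theorem cubicKForrelationProblem_mem_PromiseBQP_of (h : kForrelationProblem ∈ PromiseBQP) (k₀ : ℕ) :
    cubicKForrelationProblem k₀ ∈ PromiseBQP :=
  mem_PromiseBQP_of_subset (cubicKForrelationProblem_yes_subset k₀)
    (cubicKForrelationProblem_no_subset k₀) h

/-- The exact slice is in `PromiseBQP` as soon as explicit `k`-fold Forrelation is.
[cite: AaronsonAmbainis2018, §6 (p. 26) and §3.2 Prop. 6] -/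
theorem exactCubicForrelationProblem_mem_PromiseBQP_of (h : kForrelationProblem ∈ PromiseBQP)
    (k₀ : ℕ) : exactCubicForrelationProblem k₀ ∈ PromiseBQP :=
  mem_PromiseBQP_of_subset (exactCubicForrelationProblem_yes_subset k₀) le_rfl
    (cubicKForrelationProblem_mem_PromiseBQP_of h k₀)

/-! ### `k = 2`: the twisted sum is the Forrelation `Φ_{f,g}` -/

/-- For `k = 2` the `k`-fold forrelation is the (2-fold) forrelation:
`Φ_{f₀,f₁} = 2^{-3n/2} ∑_{x,y} f₀(x) (-1)^{x·y} f₁(y) = Φ_{f₀,f₁}` of §1.1.1.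
[cite: AaronsonAmbainis2018, §1.1.1 and §1.1.3] -/
theorem kForrelationValue_fin_two (f : Fin 2 → (Fin n → Bool) → Bool) :
    kForrelationValue f = forrelation (f 0) (f 1) := by
  unfold kForrelationValue forrelation
  rw [← (piFinTwoEquiv fun _ : Fin 2 => Fin n → Bool).symm.sum_comp, Fintype.sum_prod_type]
  congr 1
  refine Finset.sum_congr rfl fun x _ => Finset.sum_congr rfl fun y _ => ?_
  rw [Fin.prod_univ_two]
  simp [piFinTwoEquiv]
  ring

/-- The value of a two-circuit instance is the forrelation of the two computed functions.
[cite: AaronsonAmbainis2018, §1.1.1 and §6] -/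
@[simp] theorem KForrelationInstance.value_mk_two (C : Fin 2 → Circuit (Fin n)) :
    (⟨n, 2, C⟩ : KForrelationInstance).value = forrelation (C 0).eval (C 1).eval :=
  kForrelationValue_fin_two _

/-- The value of an instance with `I.k = 2` is the forrelation of its two computed functions
(indices transported along `I.k = 2`). [cite: AaronsonAmbainis2018, §1.1.1 and §6] -/
theorem KForrelationInstance.value_eq_forrelation {I : KForrelationInstance} (hk : I.k = 2) :
    I.value = forrelation (I.C (Fin.cast hk.symm 0)).eval (I.C (Fin.cast hk.symm 1)).eval := by
  obtain ⟨n, k, C⟩ := I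
  cases hk
  exact kForrelationValue_fin_two _

/-! ### Non-vacuity: a perfectly forrelated cubic pair on two bits

`f = g = x₀x₁` (the inner-product bent function on `𝔽₂¹ × 𝔽₂¹`, which is its own dual) has
`Φ_{f,g} = 1`, so the exact slice at `k₀ = 2` — and with it `cubicKForrelationProblem 2` — has a
yes-instance with `n = 2`. -/

/-- The one-gate `B₂`-circuit computing `x₀ ∧ x₁` on two inputs. [folklore] -/
def andTwoCircuit : Circuit (Fin 2) where
  gates := [⟨2, fun v => v 0 && v 1, fun a => .inl a⟩]
  output := .inr 0
  wf j h a m hm := by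
    simp only [List.length_singleton, Nat.lt_one_iff] at h
    subst h
    simp at hm
  wf_output m h := by cases h; simp

/-- `andTwoCircuit` computes `x ↦ x₀ ∧ x₁`. [folklore] -/
@[simp] theorem andTwoCircuit_eval (x : Fin 2 → Bool) : andTwoCircuit.eval x = (x 0 && x 1) := rfl

/-- `andTwoCircuit` is over `B₂` (its gate has fan-in `2`). [folklore] -/
theorem andTwoCircuit_isOver : andTwoCircuit.IsOver B2 := by
  intro g hg
  simp only [andTwoCircuit, List.mem_singleton] at hg
  subst hg
  exact le_refl 2

/-- `x₀ ∧ x₁ = [x₀x₁ = 1]` has algebraic degree `≤ 2 ≤ 3` (the monomial `X₀X₁`).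
[cite: Carlet2020, §2.2.1 Def. 6] -/
theorem isDegLeFun_andTwoCircuit_eval : IsDegLeFun 3 andTwoCircuit.eval := by
  refine ⟨MvPolynomial.X 0 * MvPolynomial.X 1, ?_, fun x => ?_⟩
  · calc (MvPolynomial.X 0 * MvPolynomial.X 1 : MvPolynomial (Fin 2) (ZMod 2)).totalDegree
          ≤ (MvPolynomial.X 0 : MvPolynomial (Fin 2) (ZMod 2)).totalDegree +
            (MvPolynomial.X 1 : MvPolynomial (Fin 2) (ZMod 2)).totalDegree :=
            MvPolynomial.totalDegree_mul _ _
      _ ≤ 1 + 1 := add_le_add (MvPolynomial.totalDegree_X (R := ZMod 2) _).le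
            (MvPolynomial.totalDegree_X (R := ZMod 2) _).le
      _ ≤ 3 := by norm_num
  · rw [andTwoCircuit_eval]
    simp only [polyPhase, map_mul, MvPolynomial.eval_X]
    cases x 0 <;> cases x 1 <;> decide

/-- The two-bit instance `(n, k, C₀, C₁) = (2, 2, x₀∧x₁, x₀∧x₁)`. [folklore] -/
def andPairInstance : KForrelationInstance := ⟨2, 2, fun _ => andTwoCircuit⟩

/-- `Φ_{f,f} = 1` for `f = (-1)^{x₀x₁}` on two bits: `∑_y (-1)^{x·y + y₀y₁} = 2 (-1)^{x₀x₁}`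
(`x₀x₁` is bent and self-dual), so `2^{-3} ∑_{x,y} = 1`. [cite: AaronsonAmbainis2018, §1.1.1] -/
theorem andPairInstance_value : andPairInstance.value = 1 := by
  show kForrelationValue (n := 2) (k := 2) (fun _ => andTwoCircuit.eval) = 1
  rw [kForrelationValue_fin_two]
  unfold forrelation
  have hs : (Real.sqrt (2 ^ (3 * 2)) : ℝ)⁻¹ = 1 / 8 := by
    rw [show ((2 : ℝ) ^ (3 * 2)) = 8 ^ 2 by norm_num, Real.sqrt_sq (by norm_num)]; norm_num
  rw [hs]
  simp only [andTwoCircuit_eval, ← (piFinTwoEquiv fun _ : Fin 2 => Bool).symm.sum_comp,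
    Fintype.sum_prod_type, Fintype.sum_bool, twist, Fin.prod_univ_two, signOf]
  simp [piFinTwoEquiv]
  norm_num

/-- **Non-vacuity**: the code of `andPairInstance` is a yes-instance of the exact cubic slice at
`k₀ = 2` (`B₂`-circuits, `Φ = 1`, `k = 2`, `n = 2` even, both functions of degree `≤ 3`).
[cite: AaronsonAmbainis2018, §1.1.3 and §6] -/
theorem encode_andPairInstance_mem_exactCubicForrelationProblem_yes :
    andPairInstance.encode ∈ (exactCubicForrelationProblem 2).yes :=
  ⟨andPairInstance, ⟨fun _ => andTwoCircuit_isOver, andPairInstance_value, rfl, ⟨1, rfl⟩,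
    fun _ => isDegLeFun_andTwoCircuit_eval⟩, rfl⟩

/-- Hence `cubicKForrelationProblem 2` has a yes-instance too. [cite: AaronsonAmbainis2018, §1.1.3 and §6] -/
theorem encode_andPairInstance_mem_cubicKForrelationProblem_yes :
    andPairInstance.encode ∈ (cubicKForrelationProblem 2).yes :=
  exactCubicForrelationProblem_yes_subset 2 encode_andPairInstance_mem_exactCubicForrelationProblem_yes

end Literature.Computability.QuantumComplexity

end
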